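import Summits.Ventures.CertifiedManyBodySolver.Downfold.EmeryFermiEnergyOf
import Summits.Ventures.CertifiedManyBodySolver.Downfold.EmeryFermiFillingGrid768
import HarnessLib

/-!
# The K-GENERIC Fermi-energy bracket of a printed σ one-body set — `pointBracketCheckK K xl xh …` on ANY certified half-angle grid `GridEncl K xl xh`, with the full
# soundness chain (bracket ⇒ existence ⇒ uniqueness ⇒ `fermiEnergyOf ν ∈ [e₁, e₂]`) (INFL-3to1-B §B.92 — the precision device for near-Lifshitz (box, filling) pairs)

Venture CertifiedManyBodySolver, cell `pub/hubbard-downfold` (stage S1), seat hubbard-downfold-mod-4 (technique B, g41); namespace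
`Summit.Ventures.CertifiedManyBodySolver.Downfold.Emery`. Everything PROVED (0 sorry; the proofs are those of `EmeryFermiScalePoint.fermiEnergy_mem_Icc_of_pointBracketCheck`,
`EmeryFermiEnergyExists.exists_fermiEnergy_of_pointBracketCheck`, `EmeryAntibondingBandContinuous.existsUnique_fermiEnergy_of_pointBracketCheck` and
`EmeryFermiEnergyOf.fermiEnergyOf_of_pointBracketCheck` with the hard-wired `K = 384` / `gridEncl384` replaced by a parameter `K` and a hypothesis `GridEncl K xl xh`).
WHY: the count resolution of the row-threshold device is ≈ 4/K in the filling (≈ 0.005–0.015 eV in ε_F at K = 384); a (box, filling) pair within that distance of a van Hove saddle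
needs a finer grid (`EmeryFermiFillingGrid768.gridEncl768`, §B.92). WHAT THIS IS NOT: anything about a material; `U = 0` σ-model kinematics; no number lives here.

* `pointBracketCheckK K xl xh Δ a b c e₁ e₂ ν₁ ν₂ jout jin` — the Bool check (outer row thresholds at `e₁` with count `< ν₁K²`, inner at `e₂` with count `> ν₂K²`, sign side conditions);
* `fermiEnergy_mem_Icc_of_pointBracketCheckK` (every ε with `abFilling ε ∈ [ν₁, ν₂]` lies in `[e₁, e₂]`), `exists_fermiEnergy_of_pointBracketCheckK`, `existsUnique_fermiEnergy_of_pointBracketCheckK`,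
  **`fermiEnergyOf_of_pointBracketCheckK`** (`abFilling (fermiEnergyOf ν) = ν ∧ fermiEnergyOf ν ∈ [e₁, e₂]` for every `ν ∈ [ν₁, ν₂]`); `…K768` = the K = 768 specialisation on `gridEncl768`.

Sources: three-band model [HybertsenSchluterChristensen1989, Eq. (1)]; [AndersenEtAl1995, §6]; interval arithmetic [folklore] (Moore 1966).
-/

noncomputable section

namespace Summit.Ventures.CertifiedManyBodySolver.Downfold.Emery

open Real Set

/-- **`pointBracketCheckK`** — the Fermi-energy bracket check of a printed one-body set at a filling window on an ARBITRARY grid `K` with tables `xl / xh`: an OUTER row-threshold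
certificate at `e₁` whose count is `< ν₁·K²` and an INNER one at `e₂` whose count is `> ν₂·K²`, with the sign side conditions (`EmeryFermiScalePoint.pointBracketCheck` is the case
`K = 384`, `xl384 / xh384`). [folklore] -/
def pointBracketCheckK (K : ℕ) (xl xh : ℕ → ℚ) (Δ a b c e₁ e₂ ν₁ ν₂ : ℚ) (jout jin : List ℕ) : Bool :=
  decide (0 ≤ e₁) && decide (e₁ ≤ e₂) && decide (0 ≤ Δ) && decide (0 ≤ a) && decide (0 ≤ b) && decide (0 ≤ c) &&
  decide (0 ≤ fsDQ Δ a c e₁) && decide (0 ≤ fsNQ a b c e₁) &&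
  decide (0 ≤ fsDQ Δ a c e₂) && decide (0 ≤ fsNQ a b c e₂) &&
  rowOuterCheck K xl (cAQ Δ e₁) (fsDQ Δ a c e₁) (fsNQ a b c e₁) (fun i => jout.getD i 0) &&
  decide (((rowSum K (fun i => jout.getD i 0) : ℕ) : ℚ) < ν₁ * (K : ℚ) ^ 2) &&
  rowInnerCheck K xh e₂ (cAQ Δ e₂) (fsDQ Δ a c e₂) (fsNQ a b c e₂) Δ (a ^ 2) (b ^ 2) (fun i => jin.getD i 0) &&
  decide (ν₂ * (K : ℚ) ^ 2 < ((rowSum K (fun i => jin.getD i 0) : ℕ) : ℚ))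

/-- **Soundness of `pointBracketCheckK`** on a certified grid: every energy `ε` whose filling lies in `[ν₁, ν₂]` lies in `[e₁, e₂]`. [folklore] -/
theorem fermiEnergy_mem_Icc_of_pointBracketCheckK {K : ℕ} (hK : 0 < K) {xl xh : ℕ → ℚ} (hG : GridEncl K xl xh)
    {Δ a b c e₁ e₂ ν₁ ν₂ : ℚ} {jout jin : List ℕ} (h : pointBracketCheckK K xl xh Δ a b c e₁ e₂ ν₁ ν₂ jout jin = true) {ε : ℝ}
    (hν : abFilling Δ a b c ε ∈ Set.Icc (ν₁ : ℝ) ν₂) : ε ∈ Set.Icc (e₁ : ℝ) e₂ := by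
  simp only [pointBracketCheckK, Bool.and_eq_true, decide_eq_true_eq] at h
  obtain ⟨⟨⟨⟨⟨⟨⟨⟨⟨⟨⟨⟨⟨he₁, he⟩, hΔ⟩, ha⟩, hb⟩, hc⟩, hD₁⟩, hN₁⟩, hD₂⟩, hN₂⟩, hout⟩, hso⟩, hin⟩, hsi⟩ := h
  have hKr : (0 : ℝ) < (K : ℝ) := by exact_mod_cast hK
  have hOutR : abFilling (Δ : ℝ) a b c (e₁ : ℝ) ≤ ((rowSum K (fun i => jout.getD i 0) : ℕ) : ℝ) / (K : ℝ) ^ 2 := by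
    refine abFilling_le_rowSum_outer hK hG hout ?_ ?_ ?_ hD₁ hN₁
    · rw [cast_cAQ]
    · rw [cast_fsDQ]
    · rw [cast_fsNQ]
  have hInR : ((rowSum K (fun i => jin.getD i 0) : ℕ) : ℝ) / (K : ℝ) ^ 2 ≤ abFilling (Δ : ℝ) a b c (e₂ : ℝ) := by
    refine rowSum_inner_le_abFilling hK hG hin ?_ ?_ ?_ hD₂ hN₂ le_rfl hΔ (by exact_mod_cast hc) ?_ ?_ (he₁.trans he)
    · rw [cast_cAQ]
    · rw [cast_fsDQ]
    · rw [cast_fsNQ]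
    · push_cast; exact le_rfl
    · push_cast; exact le_rfl
  have hso' : ((rowSum K (fun i => jout.getD i 0) : ℕ) : ℝ) / (K : ℝ) ^ 2 < (ν₁ : ℝ) := by
    rw [div_lt_iff₀ (by positivity)]
    have := (Rat.cast_lt (K := ℝ)).2 hso
    push_cast at this ⊢
    exact this
  have hsi' : (ν₂ : ℝ) < ((rowSum K (fun i => jin.getD i 0) : ℕ) : ℝ) / (K : ℝ) ^ 2 := by
    rw [lt_div_iff₀ (by positivity)]
    have := (Rat.cast_lt (K := ℝ)).2 hsi
    push_cast at this ⊢
    exact this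
  exact fermiEnergy_mem_Icc_of_abFilling_mem hOutR hso' hInR hsi' hν

/-- **EVERY CERTIFIED WINDOW HAS A FERMI ENERGY** (grid-generic): a passing `pointBracketCheckK` with `t_pd, t_pp > 0`, `t_pp′ ≤ t_pp` ⇒ every filling `ν ∈ [ν₁, ν₂]` is attained at some
`ε ∈ [e₁, e₂]`. [folklore] -/
theorem exists_fermiEnergy_of_pointBracketCheckK {K : ℕ} (hK : 0 < K) {xl xh : ℕ → ℚ} (hG : GridEncl K xl xh)
    {Δ a b c e₁ e₂ ν₁ ν₂ : ℚ} {jout jin : List ℕ} (h : pointBracketCheckK K xl xh Δ a b c e₁ e₂ ν₁ ν₂ jout jin = true) (ha : 0 < a) (hb : 0 < b) (hcb : c ≤ b)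
    {ν : ℝ} (hν : ν ∈ Icc (ν₁ : ℝ) ν₂) :
    ∃ ε : ℝ, ε ∈ Icc (e₁ : ℝ) e₂ ∧ abFilling Δ a b c ε = ν := by
  have h0 := h
  simp only [pointBracketCheckK, Bool.and_eq_true, decide_eq_true_eq] at h
  obtain ⟨⟨⟨⟨⟨⟨⟨⟨⟨⟨⟨⟨⟨he₁, he⟩, hΔ⟩, -⟩, -⟩, hc⟩, hD₁⟩, hN₁⟩, hD₂⟩, hN₂⟩, hout⟩, hso⟩, hin⟩, hsi⟩ := h
  have hKr : (0 : ℝ) < (K : ℝ) := by exact_mod_cast hK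
  have hOutR : abFilling (Δ : ℝ) a b c (e₁ : ℝ) ≤ ((rowSum K (fun i => jout.getD i 0) : ℕ) : ℝ) / (K : ℝ) ^ 2 := by
    refine abFilling_le_rowSum_outer hK hG hout ?_ ?_ ?_ hD₁ hN₁
    · rw [cast_cAQ]
    · rw [cast_fsDQ]
    · rw [cast_fsNQ]
  have hInR : ((rowSum K (fun i => jin.getD i 0) : ℕ) : ℝ) / (K : ℝ) ^ 2 ≤ abFilling (Δ : ℝ) a b c (e₂ : ℝ) := by
    refine rowSum_inner_le_abFilling hK hG hin ?_ ?_ ?_ hD₂ hN₂ le_rfl hΔ (by exact_mod_cast hc) ?_ ?_ (he₁.trans he)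
    · rw [cast_cAQ]
    · rw [cast_fsDQ]
    · rw [cast_fsNQ]
    · push_cast; exact le_rfl
    · push_cast; exact le_rfl
  have hso' : ((rowSum K (fun i => jout.getD i 0) : ℕ) : ℝ) / (K : ℝ) ^ 2 < (ν₁ : ℝ) := by
    rw [div_lt_iff₀ (by positivity)]
    have := (Rat.cast_lt (K := ℝ)).2 hso
    push_cast at this ⊢
    exact this
  have hsi' : (ν₂ : ℝ) < ((rowSum K (fun i => jin.getD i 0) : ℕ) : ℝ) / (K : ℝ) ^ 2 := by
    rw [lt_div_iff₀ (by positivity)]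
    have := (Rat.cast_lt (K := ℝ)).2 hsi
    push_cast at this ⊢
    exact this
  have hce : c * e₂ ≤ a ^ 2 := by
    unfold fsDQ at hD₂
    rcases (show 0 ≤ Δ + e₂ by linarith).lt_or_eq with hpos | hzero
    · nlinarith [(mul_nonneg_iff_of_pos_left hpos).mp hD₂]
    · have : e₂ = 0 := by linarith
      rw [this, mul_zero]; positivity
  have hcont : ContinuousOn (abFilling (Δ : ℝ) a b c) (Icc (e₁ : ℝ) e₂) :=
    continuousOn_abFilling_Icc (by exact_mod_cast hΔ) (by exact_mod_cast ha) (by exact_mod_cast hb) (by exact_mod_cast hc)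
      (by exact_mod_cast hcb) (by exact_mod_cast he₁) (by exact_mod_cast hce)
  obtain ⟨ε, hε, hfε⟩ := exists_fermiEnergy (ν := ν) (by exact_mod_cast he) hcont (by linarith [hν.1]) (by linarith [hν.2])
  exact ⟨ε, hε, hfε⟩

/-- **EXACTLY ONE FERMI ENERGY PER FILLING** (grid-generic): a passing `pointBracketCheckK` with `t_pd, t_pp > 0`, `t_pp′ ≤ t_pp` ⇒ for every `ν ∈ [ν₁, ν₂]` there is a UNIQUE `ε` with
`abFilling ε = ν`, and it lies in `[e₁, e₂]`. [folklore] -/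
theorem existsUnique_fermiEnergy_of_pointBracketCheckK {K : ℕ} (hK : 0 < K) {xl xh : ℕ → ℚ} (hG : GridEncl K xl xh)
    {Δ a b c e₁ e₂ ν₁ ν₂ : ℚ} {jout jin : List ℕ} (h : pointBracketCheckK K xl xh Δ a b c e₁ e₂ ν₁ ν₂ jout jin = true) (ha : 0 < a) (hb : 0 < b) (hcb : c ≤ b)
    {ν : ℝ} (hν : ν ∈ Icc (ν₁ : ℝ) ν₂) :
    (∃! ε : ℝ, abFilling Δ a b c ε = ν) ∧ ∀ ε : ℝ, abFilling Δ a b c ε = ν → ε ∈ Icc (e₁ : ℝ) e₂ := by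
  obtain ⟨ε, hε, hfε⟩ := exists_fermiEnergy_of_pointBracketCheckK hK hG h ha hb hcb hν
  have hbr : ∀ ε' : ℝ, abFilling (Δ : ℝ) a b c ε' ∈ Set.Icc (ν₁ : ℝ) ν₂ → ε' ∈ Set.Icc (e₁ : ℝ) e₂ :=
    fun ε' hε' => fermiEnergy_mem_Icc_of_pointBracketCheckK hK hG h hε'
  simp only [pointBracketCheckK, Bool.and_eq_true, decide_eq_true_eq] at h
  obtain ⟨⟨⟨⟨⟨⟨⟨⟨⟨⟨⟨⟨⟨he₁, he⟩, hΔ⟩, -⟩, hb0⟩, hc⟩, hD₁⟩, hN₁⟩, hD₂⟩, hN₂⟩, hout⟩, hso⟩, hin⟩, hsi⟩ := h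
  have hKr : (0 : ℝ) < (K : ℝ) := by exact_mod_cast hK
  have hso' : (0 : ℝ) < (ν₁ : ℝ) := by
    have h1 : (0 : ℚ) ≤ ((rowSum K (fun i => jout.getD i 0) : ℕ) : ℚ) := Nat.cast_nonneg _
    have hKq : (0 : ℚ) < (K : ℚ) ^ 2 := by positivity
    have : (0 : ℚ) < ν₁ * (K : ℚ) ^ 2 := lt_of_le_of_lt h1 hso
    have : (0 : ℚ) < ν₁ := by
      by_contra hle
      push Not at hle
      have : ν₁ * (K : ℚ) ^ 2 ≤ 0 := mul_nonpos_of_nonpos_of_nonneg hle hKq.le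
      linarith
    exact_mod_cast this
  have hInR : ((rowSum K (fun i => jin.getD i 0) : ℕ) : ℝ) / (K : ℝ) ^ 2 ≤ abFilling (Δ : ℝ) a b c (e₂ : ℝ) := by
    refine rowSum_inner_le_abFilling hK hG hin ?_ ?_ ?_ hD₂ hN₂ le_rfl hΔ (by exact_mod_cast hc) ?_ ?_ (he₁.trans he)
    · rw [cast_cAQ]
    · rw [cast_fsDQ]
    · rw [cast_fsNQ]
    · push_cast; exact le_rfl
    · push_cast; exact le_rfl
  have hsi' : (ν₂ : ℝ) < ((rowSum K (fun i => jin.getD i 0) : ℕ) : ℝ) / (K : ℝ) ^ 2 := by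
    rw [lt_div_iff₀ (by positivity)]
    have := (Rat.cast_lt (K := ℝ)).2 hsi
    push_cast at this ⊢
    exact this
  have hν1 : ν < 1 := by
    have := abFilling_le_one (Δ : ℝ) a b c (e₂ : ℝ)
    linarith [hν.2]
  have hν0 : 0 < ν := lt_of_lt_of_le hso' hν.1
  have huniq : ∀ ε' : ℝ, abFilling Δ a b c ε' = ν → ε' = ε := fun ε' h' =>
    fermiEnergy_unique (by exact_mod_cast hΔ) (by exact_mod_cast hc) (by exact_mod_cast hb0) hν0 hν1 h' hfε
  refine ⟨⟨ε, hfε, huniq⟩, fun ε' h' => ?_⟩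
  rw [huniq ε' h']; exact hε

/-- **THE FERMI ENERGY OF A CERTIFIED WINDOW** (grid-generic): a passing `pointBracketCheckK` with `t_pd, t_pp > 0`, `t_pp′ ≤ t_pp` ⇒ for every `ν ∈ [ν₁, ν₂]`:
`abFilling (fermiEnergyOf ν) = ν` and `fermiEnergyOf ν ∈ [e₁, e₂]`. [folklore] -/
theorem fermiEnergyOf_of_pointBracketCheckK {K : ℕ} (hK : 0 < K) {xl xh : ℕ → ℚ} (hG : GridEncl K xl xh)
    {Δ a b c e₁ e₂ ν₁ ν₂ : ℚ} {jout jin : List ℕ} (h : pointBracketCheckK K xl xh Δ a b c e₁ e₂ ν₁ ν₂ jout jin = true) (ha : 0 < a) (hb : 0 < b) (hcb : c ≤ b)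
    {ν : ℝ} (hν : ν ∈ Icc (ν₁ : ℝ) ν₂) :
    abFilling Δ a b c (fermiEnergyOf Δ a b c ν) = ν ∧ fermiEnergyOf (Δ : ℝ) a b c ν ∈ Icc (e₁ : ℝ) e₂ := by
  obtain ⟨⟨ε, hε, huniq⟩, hbr⟩ := existsUnique_fermiEnergy_of_pointBracketCheckK hK hG h ha hb hcb hν
  have h' := h
  simp only [pointBracketCheckK, Bool.and_eq_true, decide_eq_true_eq] at h'
  obtain ⟨⟨⟨⟨⟨⟨⟨⟨⟨⟨⟨⟨⟨-, -⟩, hΔ⟩, -⟩, hb0⟩, hc⟩, -⟩, -⟩, -⟩, -⟩, -⟩, -⟩, -⟩, -⟩ := h'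
  have hν0 : 0 < ν := by
    by_contra hle
    push Not at hle
    have hfill0 : abFilling (Δ : ℝ) a b c (-1) = 0 :=
      abFilling_of_neg (by exact_mod_cast hΔ) (by exact_mod_cast hc) (by exact_mod_cast hb0) (by norm_num)
    have hνnn : 0 ≤ ν := by rw [← hε]; exact abFilling_nonneg _ _ _ _ _
    have hν00 : ν = 0 := le_antisymm hle hνnn
    have h1 := huniq (-1) (show abFilling (Δ : ℝ) a b c (-1) = ν by rw [hfill0, hν00])
    have hfill2 : abFilling (Δ : ℝ) a b c (-2) = 0 :=
      abFilling_of_neg (by exact_mod_cast hΔ) (by exact_mod_cast hc) (by exact_mod_cast hb0) (by norm_num)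
    have h2 := huniq (-2) (show abFilling (Δ : ℝ) a b c (-2) = ν by rw [hfill2, hν00])
    linarith
  have hν1 : ν < 1 := by
    by_contra hge
    push Not at hge
    have hle1 : ν ≤ 1 := by rw [← hε]; exact abFilling_le_one _ _ _ _ _
    have hν11 : ν = 1 := le_antisymm hle1 hge
    have hmono := abFilling_mono (Δ : ℝ) a b c (show ε ≤ ε + 1 by linarith)
    have h1 : abFilling (Δ : ℝ) a b c (ε + 1) = ν :=
      le_antisymm (by rw [hν11]; exact abFilling_le_one _ _ _ _ _) (by rw [← hε]; exact hmono)
    have := huniq (ε + 1) (show abFilling (Δ : ℝ) a b c (ε + 1) = ν from h1)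
    linarith
  have hΔr : (0 : ℝ) ≤ Δ := by exact_mod_cast hΔ
  have hcr : (0 : ℝ) ≤ c := by exact_mod_cast hc
  have hbr' : (0 : ℝ) ≤ b := by exact_mod_cast hb0
  have heq := fermiEnergyOf_eq_of_abFilling_eq hΔr hcr hbr' hν0 hν1 hε
  refine ⟨by rw [heq]; exact hε, by rw [heq]; exact hbr ε hε⟩

/-! ## The `K = 768` specialisation -/

/-- `pointBracketCheckK` on the certified `K = 768` grid: `fermiEnergyOf ν ∈ [e₁, e₂]` (and `abFilling (fermiEnergyOf ν) = ν`) for every `ν ∈ [ν₁, ν₂]`. [folklore] -/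
theorem fermiEnergyOf_of_pointBracketCheckK768 {Δ a b c e₁ e₂ ν₁ ν₂ : ℚ} {jout jin : List ℕ}
    (h : pointBracketCheckK 768 xl768 xh768 Δ a b c e₁ e₂ ν₁ ν₂ jout jin = true) (ha : 0 < a) (hb : 0 < b) (hcb : c ≤ b)
    {ν : ℝ} (hν : ν ∈ Icc (ν₁ : ℝ) ν₂) :
    abFilling Δ a b c (fermiEnergyOf Δ a b c ν) = ν ∧ fermiEnergyOf (Δ : ℝ) a b c ν ∈ Icc (e₁ : ℝ) e₂ :=
  fermiEnergyOf_of_pointBracketCheckK (by norm_num) gridEncl768 h ha hb hcb hν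

end Summit.Ventures.CertifiedManyBodySolver.Downfold.Emery
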